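import Literature.NumberTheory.EllipticCurves.TakahashiRankOneOfEichlerSelberg
import HarnessLib

/-!
# Stub ideas k3 — GENERATION 4 (FAMILY 3, probe the extremes) for `stub_takahashi`
# (`takahashi2001_thm_2_3_of_coprime`), crux `DefiniteRTControlPrime`, route `DefiniteXi`

Scratch sketch (ideator's folder; elaboration sanity of the NEW helper-lemma signatures only).
Retained by reference: gen-1 `StubIdeas3Sketch.lean` (H1/H2 split, `eigenLattice_isLine_of_stub`),
gen-2 `StubIdeas3g2Sketch.lean` (L1–L6, H0, H1; `existsLevelPowModel_holds`; proved glue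
`traceMatrixEqSumInvWeightAddCoprime_of`, `pizerTraceIdentityCoprime_of`, `rankOneCoprime_of`).

Gen-4 content: the single live lemma `L3 = LocalChainIdentityPow` (Brandt local embedding numbers at
`q^e ∥ M` versus the Cohen–Oesterlé density `localDensity (q^e) 1 t f n`, chain-summed) is the
equality of the two groupings of ONE local count ("orbital integral" of the level-`q^e` Eichler order
at `γ`): grouping the `γ`-stable level structures by OPTIMAL ORDER gives the Brandt side (Eichler),
grouping them by LATTICE gives fixed-point counts on `ℙ¹(ℤ/q^e)` (Selberg–Zagier–Oesterlé), and the
fixed-point count of the multiplication-by-`γ` matrix on `B_f` is exactly `μ_{q^e}(t, f, n)` (`O3`,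
Popa's Lemma 6.1 at prime-power level; brute-force certified `q ∈ {2,3,5}`, `e ≤ 5`, 460 cases, 0
mismatches, `scratch/popa_pow_check.py`).  Uniform in `e` — no Hijikata case table, no resummation
polynomial identities; at `e = 1` it re-proves the tree's `chain_identity_level`.
-/

noncomputable section

open scoped BigOperators Matrix
open Finset

set_option linter.dupNamespace false

namespace Summit.ABC.ABC.Cruxes.DefiniteRTControlPrime.StubIdeas3g4

open Literature.NumberTheory.EllipticCurves
open Literature.NumberTheory.Automorphic Literature.NumberTheory.Automorphic.Brandt
open Literature.NumberTheory.Automorphic.HeckeTraceFormulaGL2Level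

/-! ### O3 — fixed points on `ℙ¹(ℤ/q^e)` = the CO local density (Popa L.6.1 at prime powers) -/

/-- Unimodular vectors of `(ℤ/N)²` fixed PROJECTIVELY by the integer matrix `A`
(`A v = c v` for some scalar `c`); their number is `φ(N) · #Fix(A | ℙ¹(ℤ/N))`. -/
def fixedUnimodular (N : ℕ) [NeZero N] (A : Matrix (Fin 2) (Fin 2) ℤ) : Finset (Fin 2 → ZMod N) := by
  classical
  exact Finset.univ.filter fun v =>
    (IsUnit (v 0) ∨ IsUnit (v 1)) ∧ ∃ c : ZMod N, (A.map (Int.cast : ℤ → ZMod N)) *ᵥ v = c • v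

/-- The content `gcd(c, d - a, b)` of `A = (a b; c d)` (the conductor of `ℤ[A]` over `ℤ`). -/
def content (A : Matrix (Fin 2) (Fin 2) ℤ) : ℕ := Int.gcd (Int.gcd (A 1 0) (A 1 1 - A 0 0)) (A 0 1)

/-- **O3 (M).** For `q ∤ n = det A`: `#fixedUnimodular_{q^e}(A) = φ(q^e) · μ_{q^e}(tr A, content A, det A)`
— the Cohen–Oesterlé density IS the fixed-point count of `A` on `ℙ¹(ℤ/q^e)`.  Proof sketch: write
`A = a' + u A₀`, `A₀` primitive, `ρ = v_q(u)`; if `ρ ≥ e` every point is fixed (`ψ(q^e)`, and the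
congruence `x² - tx + n ≡ 0 (q^{2e})` has exactly one root mod `q^e`); if `ρ < e` the fixed points are
the fibres (`q^ρ = ψ(q^e)/ψ(q^{e-ρ})` each) over the fixed points of `A₀` mod `q^{e-ρ}`, which are the
roots of its characteristic polynomial (a primitive `2 × 2` matrix is regular), and
`x = a' + u λ` turns `x² - tx + n` into `u² (λ² - t₀ λ + n₀)`. [Popa arXiv:1408.4998 L.6.1 (square-free);
prime powers: certified numerically here] -/
def PopaCountPrimePow : Prop :=
  ∀ (q e : ℕ) [Fact q.Prime], 1 ≤ e → ∀ (A : Matrix (Fin 2) (Fin 2) ℤ) (n : ℕ),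
    A.det = (n : ℤ) → n.Coprime q →
    haveI : NeZero (q ^ e) := ⟨pow_ne_zero _ (Fact.out : q.Prime).ne_zero⟩
    ((fixedUnimodular (q ^ e) A).card : ℂ) =
      (Nat.totient (q ^ e) : ℂ) * localDensity (q ^ e) 1 A.trace (content A) n

/-! ### O3′ — the matrix of `γ` on `B_f = ℤ ⊕ ℤ σ_f` (basis `(1, σ_f)`, `γ = f σ_f - s`,
`σ_f² = t_f σ_f - n_f`, `s = shift t n`): trace `t`, determinant `n`, content `f`. -/

/-- Multiplication by `γ` on `B_f` in the basis `(1, σ_f)`. -/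
def gammaMatrix (t : ℤ) (n f : ℕ) : Matrix (Fin 2) (Fin 2) ℤ :=
  !![-shift t n, -((f : ℤ) * nOf t n f); (f : ℤ), (f : ℤ) * tOf t n f - shift t n]

/-- **O3′ (S).** `tr = t`, `det = n`, `content = f` for `f ∈ ellipticConductors t n`
(`mul_tOf`, `sq_mul_nOf` in `QuadraticOrdersConductors`); hence by O3
`#fixedUnimodular_{q^e}(gammaMatrix t n f) = φ(q^e) μ_{q^e}(t, f, n)`. -/
def GammaMatrixFixedCount : Prop :=
  ∀ (q e : ℕ) [Fact q.Prime], 1 ≤ e → ∀ (t : ℤ) (n f : ℕ), t ^ 2 < 4 * n → n.Coprime q →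
    f ∈ ellipticConductors t n →
    haveI : NeZero (q ^ e) := ⟨pow_ne_zero _ (Fact.out : q.Prime).ne_zero⟩
    ((fixedUnimodular (q ^ e) (gammaMatrix t n f)).card : ℂ) =
      (Nat.totient (q ^ e) : ℂ) * localDensity (q ^ e) 1 t f n

/-! ### O1+O2 — the orbital regrouping (Eichler grouping = Selberg grouping), chain-summed.
LHS: Brandt local embedding numbers `m_q(B_f)` of the orders of the `q`-chains into `O_(q)` (Eichler,
level `q^e`, `e = ord_q M`, model `existsLevelPowModel_holds`); RHS: fixed points of `γ` on
`B_f ⊗ ℤ/q^e`.  Both sides count the `ℚ(γ)ˣ`-classes of `γ`-stable translates `x • O_(q)`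
(= `γ`-stable pairs of lattices `L ⊋ L' ⊇ q^e L`, `L/L'` cyclic) with weight `[B_top,qˣ : Stab]`:
by optimal order (`Stab = B_fˣ`, weight `= chainW` = `Chain.hw_eq`) or by the lattice `L`
(O2: a `γ`-stable `ℤ_q`-lattice of `ℚ_q(γ)` is `c · B_f` for a unique chain member, `Stab = B_fˣ`,
then orbit–stabiliser on the `L'`). -/
def OrbitalRegroupingPow : Prop :=
  ∀ {M p : ℕ} (S : XiSetup M p), M ≠ 0 → p.Prime → ¬ p ∣ M →
    ∀ {γ : S.D} {t : ℤ} {n : ℕ}, GammaHyp γ t n → n.Coprime M →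
    ∀ {q : ℕ} [Fact q.Prime], q ∣ M →
    ∀ A : ℕ → ℚ, (∀ f ∈ ellipticConductors t n, f * q ∈ ellipticConductors t n → A (f * q) = A f) →
      haveI : NeZero (q ^ M.factorization q) := ⟨pow_ne_zero _ (Fact.out : q.Prime).ne_zero⟩
      ∑ f ∈ ellipticConductors t n,
          hw t n f * A f * (localEmbeddingNumber S.O γ (ordOf γ t n f) q : ℚ) =
        ∑ f ∈ ellipticConductors t n,
          hw t n f * A f *
            (((fixedUnimodular (q ^ M.factorization q) (gammaMatrix t n f)).card : ℚ) /
              (Nat.totient (q ^ M.factorization q) : ℚ))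

/-! ### Assembly of L3 from O1+O2 and O3′ (cast bookkeeping only) -/

/-- gen-2's `L3`, restated verbatim (the assembly target BY NAME is
`StubIdeas3g2.LocalChainIdentityPow`; restated here only because crux-dir sketch modules are not
in the farm snapshot). -/
def LocalChainIdentityPow : Prop :=
  ∀ {M p : ℕ} (S : XiSetup M p), M ≠ 0 → p.Prime → ¬ p ∣ M →
    ∀ {γ : S.D} {t : ℤ} {n : ℕ}, GammaHyp γ t n → n.Coprime M →
    ∀ {q : ℕ}, q.Prime → q ∣ M →
    ∀ A : ℕ → ℚ, (∀ f ∈ ellipticConductors t n, f * q ∈ ellipticConductors t n → A (f * q) = A f) →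
      (((∑ f ∈ ellipticConductors t n,
          hw t n f * A f * (localEmbeddingNumber S.O γ (ordOf γ t n f) q : ℚ)) : ℚ) : ℂ) =
        ∑ f ∈ ellipticConductors t n,
          ((hw t n f * A f : ℚ) : ℂ) * localDensity (q ^ M.factorization q) 1 t f n

/-- **Assembly (PROVED): O1+O2 and O3′ give gen-2's L3** (then gen-2's proved glue:
L3 → L4 `EllipticTermEqCoprime` (with L1, L3b) → L5 → L6 → H0 `PizerTraceIdentityCoprime`
(`pizerTraceIdentityCoprime_of`, `hES := HeckeTraceFormulaGL2Level`) → H1 (`rankOneCoprime_of`) →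
stub (k2-g2 `stub_of_pinned H1 T♭`)). -/
theorem localChainIdentityPow_of (h12 : OrbitalRegroupingPow) (h3 : GammaMatrixFixedCount) :
    LocalChainIdentityPow := by
  intro M p S hM hp hpM γ t n hγ hn q hq hqM A hA
  haveI : Fact q.Prime := ⟨hq⟩
  have he : 1 ≤ M.factorization q := Nat.Prime.factorization_pos_of_dvd hq hM hqM
  have hnq : n.Coprime q := Nat.Coprime.coprime_dvd_right hqM hn
  have hφ : (Nat.totient (q ^ M.factorization q) : ℂ) ≠ 0 := by
    exact_mod_cast (Nat.totient_pos.mpr (pow_pos hq.pos _)).ne'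
  have H := h12 S hM hp hpM hγ hn (q := q) hqM A hA
  rw [H]
  push_cast
  refine Finset.sum_congr rfl fun f hf => ?_
  rw [h3 q (M.factorization q) he t n f hγ.hlt hnq hf, mul_div_cancel_left₀ _ hφ]

end Summit.ABC.ABC.Cruxes.DefiniteRTControlPrime.StubIdeas3g4
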